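import Summits.QuantumFields.YangMills.Theorems.BalabanLadderIRAbstractBasinRung24
import HarnessLib

/-!
# Crux `IR` (stmt-QuantumFields-19354) — BILL OF RECORD `exit-bill-24`: `IR ⇐ E(1∕24) ∧ X ∧ N`

Registered skeleton of the LEAD prover `ym-ir-line-ab-p1` (director-ym №14 (4) ∕ №15: «re-base the E-bills' seed on
the weakest PROVED entry»; RULING g9-№1 (2) pre-announced on `pub/ym-ir/STATUS.md` 2026-08-28T04:53:39Z).
A THIN RE-EXPORT over landed theorems — no mathematics lives here:

* the currency `coldDefect` ∕ `ColdDoublingRecursionSC` (R, CLOSED: `AspectBootstrap.coldDoublingRecursionSC_holds`,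
  p596893) is idea-6's (`Theorems/BalabanLadderIRColdPurityBridge.lean`);
* the seed `BasinRung.ColdExitAt θ` and the group-free abstract-basin ladder `2⁻²⁴ → 2⁻⁹ → 2⁻⁸ → 2⁻⁶ → 1∕24`
  (`Theorems/BalabanLadderIRAbstractBasinRung{,8,6,24}.lean`, p602096 ∕ p603051 ∕ p603750 ∕ p604479) are idea-9's line
  `basin-transfer` (critic ym-ir-crit-3 PASS-WITH-PRICE);
* the composition is `BasinRung.IR_of_exitAt24 : ColdExitAt (1/24) → AFToColdPressure → IRnsc → Theses.BalabanLadder.IR`.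

STUBS (three; each is a hypothesis Prop of the tree, restated by NAME only):
* `stub_seed24 : BasinRung.ColdExitAt (1/24)` — **E(1∕24), THE NUMBER** (width 0 on the critics' ledger): for every compact
  simple simply-connected `G` and lattice representation `r`, beyond some `β₁`, at EVERY `β ≥ β₁` ONE cold 4:1 torus `L ≥ 8` with
  `coldDefect r.ρ β L ≤ 1∕24` (purity `Z_β(L³×2⌊L∕4⌋) ∕ Z_β(L³×⌊L∕4⌋)² ≥ 23∕24`); `pub/ym-ir/FINITE-BOX-PURITY.md` unfolds it in
  words and numbers (β_W = 2.4, SU(2): ≈ 36–40 a, GUIDANCE).  False for `U(1)₄` ∕ `SO(3)` light modes — the binders are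
  load-bearing (`Theorems/ColdExitSC/Negative/ColdExitFalseOfLightFlux.lean`, p605461).
* `stub_afToColdPressure : ColdPressurePincer.AFToColdPressure` — **X**, the UV input (asymptotic freedom of `Q2` up to the
  cold-pressure length; shared with the cell's other E-bills; floor-units re-base = planner task, director №14 (6)).
* `stub_irnsc : ColdPressurePincer.IRnsc` — **N**, the residual of record (IR for the non-simply-connected simple groups).

Superseded as slot of record (stays published, lines_any): `Lines/floor_handshake.lean` rev 2 {H = `FloorToPuritySC`, N}
(idea-6; H ⇐ E ∧ X_pur ∧ R).  HONEST FRAMING: nothing here proves the Yang–Mills mass gap (Clay) or `BalabanLadder.IR`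
(0∕1 open); the three stubs carry ALL the content; R4 closes only the conditional finite-𝕋⁴ rung `BalabanLadder.UV`.
-/

namespace Summit.QuantumFields.YangMills.Cruxes.IR.ExitBill24

open Summit.QuantumFields.YangMills.Cruxes.IR.BasinRung (ColdExitAt IR_of_exitAt24)
open Summit.QuantumFields.YangMills.Cruxes.IR.ColdPressurePincer (AFToColdPressure IRnsc)

/-! ## §1 Stubs -/

/-- **E(1∕24) — the seed (THE NUMBER).**  `∀ G simple simply-connected, ∀ r, ∃ β₁, ∀ β ≥ β₁, ∃ L ≥ 8, coldDefect r.ρ β L ≤ 1∕24`. -/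
theorem stub_seed24 : ColdExitAt (1 / 24) := by
  sorry

/-- **X — asymptotic freedom up to the cold-pressure length** (`ColdPressurePincer.AFToColdPressure`, by name). -/
theorem stub_afToColdPressure : AFToColdPressure := by
  sorry

/-- **N — the residual of record** (`ColdPressurePincer.IRnsc`: `IR` for the non-simply-connected simple groups, by name). -/
theorem stub_irnsc : IRnsc := by
  sorry

/-! ## §2 Composition (landed: `BasinRung.IR_of_exitAt24`, p604479) -/

/-- `E(1∕24) ∧ X ∧ N ⇒ IR` — the landed composition, re-exported under this line's name. -/
theorem IR_of (hE : ColdExitAt (1 / 24)) (hX : AFToColdPressure) (hN : IRnsc) :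
    Summit.QuantumFields.YangMills.Theses.BalabanLadder.IR :=
  IR_of_exitAt24 hE hX hN

/-- **The crux BY NAME, modulo the three stubs** (depends on `sorryAx` through the stubs only). -/
theorem IR_of_stubs : Summit.QuantumFields.YangMills.Theses.BalabanLadder.IR :=
  IR_of stub_seed24 stub_afToColdPressure stub_irnsc

end Summit.QuantumFields.YangMills.Cruxes.IR.ExitBill24
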